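import Literature.Analysis.SpecialFunctions.SelbergLaplace
import Literature.Analysis.SpecialFunctions.SelbergAomoto
import Literature.Analysis.SpecialFunctions.SelbergProductAlgebra
import HarnessLib

/-!
# Proof of Selberg's integral formula

We discharge the named fact `Literature.Analysis.SpecialFunctions.selberg_integral_formula`
(A. Selberg, Norsk Mat. Tidsskr. 26 (1944) 71–78; P. J. Forrester, S. O. Warnaar, Bull. AMS 45
(2008), (1.1)–(1.2); G. E. Andrews, R. Askey, R. Roy, *Special Functions* (1999), Thm. 8.1.1 and
§8.2) by assembling the layers proved in the sibling files:

1. **Aomoto's recurrence in `a`** (`Selberg.selbergIntegral_add_one`, regime `a, b, c ≥ 1`) and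
   its Gamma-side twin (`Selberg.selbergProduct_add_one`); log-convexity of both sides in `a`
   (`Selberg.convexOn_log_selbergIntegral`, `Selberg.convexOn_log_selbergProduct`); a
   Bohr–Mollerup-type uniqueness theorem (`Selberg.BohrMollerup.eq_of_logConvex`) then gives
   `S = K(b,c) · G` for `a ≥ 1`.
2. **Landau-type continuation in `a`** (`Selberg.Landau.integrable_and_mgf_eq`, with the Selberg
   integral written as a Laplace transform, `Selberg.selbergIntegral_eq_mgf_A`) extends this to
   `a > 0`.
3. **Selberg's normalisation**: `a S_{m+1}(a,b,c) → (m+1) S_m(2c,b,c)` and the same for the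
   product side force `K = 1`, by induction on the dimension (base case: Euler's Beta integral).
4. **Continuation in `b` and in `c`** (Landau again, `selbergIntegral_eq_mgf_B/C`): the product
   side is holomorphic in `c` on the half-plane `Re c > -min{1/n, a/(n-1), b/(n-1)}`, so the
   integral converges and the formula holds on the whole Forrester–Warnaar domain (1.2) — in
   particular no separate convergence proof for negative `c` is needed (Landau's theorem: the
   abscissa of convergence of the Laplace transform of a positive measure is a singularity).

Everything here is fully proved; no definitions, no named facts.
-/

noncomputable section

open MeasureTheory ProbabilityTheory Real Finset Set Filter Topology

namespace Literature.Analysis.SpecialFunctions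

namespace Selberg

/-! ### Step A: `S = K · G` on `a > 0`, for fixed `b, c ≥ 1` -/

/-- The multiplier of the recurrence tends to `1` as `a → ∞`. [folklore] -/
theorem tendsto_multiplier (n : ℕ) (b c : ℝ) :
    Tendsto (fun a : ℝ => ∏ j ∈ range n, (a + j * c) / (a + b + ((n : ℝ) + j - 1) * c)) atTop
      (𝓝 1) := by
  have h : ∀ j : ℕ, Tendsto (fun a : ℝ => (a + j * c) / (a + b + ((n : ℝ) + j - 1) * c)) atTop
      (𝓝 1) := by
    intro j
    set q : ℝ := b + ((n : ℝ) + j - 1) * c with hq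
    have hden : Tendsto (fun a : ℝ => a + q) atTop atTop := tendsto_atTop_add_const_right _ _ tendsto_id
    have h0 : Tendsto (fun a : ℝ => (j * c - q) / (a + q)) atTop (𝓝 0) :=
      tendsto_const_nhds.div_atTop hden
    have h1 : Tendsto (fun a : ℝ => 1 + (j * c - q) / (a + q)) atTop (𝓝 (1 + 0)) :=
      tendsto_const_nhds.add h0
    rw [add_zero] at h1
    refine h1.congr' ?_
    filter_upwards [eventually_gt_atTop (-q)] with a ha
    have hne : a + q ≠ 0 := by linarith
    rw [show a + b + ((n : ℝ) + j - 1) * c = a + q by rw [hq]; ring]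
    field_simp
    ring
  have := tendsto_finsetProd (range n) fun j _ => h j
  simpa using this

/-- **Step A.** For `b, c ≥ 1` there is `K > 0` with `S_{m+1}(a,b,c) = K · selbergProduct (m+1) a b c`
for all `a > 0`: Bohr–Mollerup uniqueness on `a ≥ 1`, then Landau continuation in `a`.
[folklore] -/
theorem exists_const_mul (m : ℕ) {b c : ℝ} (hb : 1 ≤ b) (hc : 1 ≤ c) :
    ∃ K : ℝ, 0 < K ∧ ∀ a : ℝ, 0 < a →
      selbergIntegral (m + 1) a b c = K * selbergProduct (m + 1) a b c := by
  have hb0 : 0 < b := by linarith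
  have hc0 : 0 ≤ c := by linarith
  -- the data of the Bohr–Mollerup argument
  set f : ℝ → ℝ := fun a => selbergIntegral (m + 1) a b c with hf
  set g : ℝ → ℝ := fun a => selbergProduct (m + 1) a b c with hg
  set r : ℝ → ℝ := fun a =>
    ∏ j ∈ range (m + 1), (a + j * c) / (a + b + (((m + 1 : ℕ) : ℝ) + j - 1) * c) with hr
  have hfpos : ∀ x, 1 ≤ x → 0 < f x := fun x hx =>
    selbergIntegral_pos_of_nonneg (by linarith) hb0 hc0
  have hgpos : ∀ x, 1 ≤ x → 0 < g x := fun x hx =>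
    selbergProduct_pos_of_nonneg (by omega) (by linarith) hb0 hc0
  have hrpos : ∀ x, 1 ≤ x → 0 < r x := fun x hx => multiplier_pos (m + 1) (by linarith) hb0 hc0
  have hsub : Set.Ici (1 : ℝ) ⊆ Set.Ioi 0 := fun x hx =>
    Set.mem_Ioi.2 (lt_of_lt_of_le zero_lt_one (Set.mem_Ici.1 hx))
  have hfc : ConvexOn ℝ (Set.Ici 1) fun x => Real.log (f x) :=
    (convexOn_log_selbergIntegral (m + 1) hb0 hc0).subset hsub (convex_Ici 1)
  have hgc : ConvexOn ℝ (Set.Ici 1) fun x => Real.log (g x) :=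
    (convexOn_log_selbergProduct m hb0 hc0).subset hsub (convex_Ici 1)
  have hfr : ∀ x, 1 ≤ x → f (x + 1) = r x * f x := fun x hx => by
    simp only [hf, hr]
    rw [selbergIntegral_add_one hx hb hc, mul_comm]
  have hgr : ∀ x, 1 ≤ x → g (x + 1) = r x * g x := fun x hx => by
    simp only [hg, hr]
    rw [selbergProduct_add_one_of_nonneg (m + 1) (by linarith) hb0 hc0, mul_comm]
  have hlim : Tendsto r atTop (𝓝 1) := tendsto_multiplier (m + 1) b c
  -- Bohr–Mollerup: `f = K g` on `[1, ∞)`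
  set K : ℝ := f 1 / g 1 with hK
  have hK0 : 0 < K := div_pos (hfpos 1 le_rfl) (hgpos 1 le_rfl)
  have hBM : ∀ a, 1 ≤ a → f a = K * g a := by
    intro a ha
    have h := BohrMollerup.eq_of_logConvex hfpos hgpos hrpos hfc hgc hfr hgr hlim ha
    have hg1 := (hgpos 1 le_rfl).ne'
    simp only [hK]
    field_simp
    linear_combination h
  refine ⟨K, hK0, ?_⟩
  -- Landau continuation in `a`
  set μ := cubeMeasure (m + 1) (densA (m + 1) b c) with hμ
  have hmgf : ∀ s : ℝ, mgf (XA (m + 1)) μ s = selbergIntegral (m + 1) (s + 1) b c := fun s => by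
    rw [selbergIntegral_eq_mgf_A, add_sub_cancel_right]
  set G : ℂ → ℂ := fun z => (K : ℂ) * selbergProductC (m + 1) (z + 1) b c with hG
  have hGdiff : DifferentiableOn ℂ G {z : ℂ | -1 < z.re} := by
    simp only [hG]
    refine DifferentiableOn.const_mul ?_ _
    refine differentiableOn_selbergProductC (by fun_prop) (by fun_prop) (by fun_prop)
      ?_ ?_ ?_ ?_ ?_ <;> intro z hz <;> simp only [Set.mem_setOf_eq] at hz
    · intro j hj; simp; nlinarith [hz, hc0, (by positivity : (0 : ℝ) ≤ j)]
    · intro j hj; simp; positivity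
    · intro j hj; simp; positivity
    · intro j hj
      simp
      have : (0 : ℝ) ≤ (m : ℝ) + 1 + j - 1 := by
        have : ((j : ℝ) + 1) ≤ (m : ℝ) + 1 := by exact_mod_cast hj
        linarith [(by positivity : (0 : ℝ) ≤ j)]
      nlinarith [hz, hc0, hb0]
    · simp; linarith
  have hL := Landau.integrable_and_mgf_eq (μ := μ) (X := XA (m + 1)) (XA_nonpos (m + 1) b c)
    (a := -1) (s₁ := 0) (by norm_num) hGdiff
    (fun s hs => (integrable_exp_XA_iff b c s).2 (integrableOn_weight (by linarith) hb0 hc0))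
    (fun s hs => by
      rw [hmgf, show selbergIntegral (m + 1) (s + 1) b c = f (s + 1) from rfl,
        hBM (s + 1) (by linarith)]
      simp only [hg, hG]
      push_cast
      rw [← Complex.ofReal_one, ← Complex.ofReal_add, selbergProductC_ofReal])
  intro a ha
  have h := (hL (a - 1) (by linarith)).2
  rw [hmgf, sub_add_cancel] at h
  simp only [hG] at h
  push_cast at h
  rw [sub_add_cancel, selbergProductC_ofReal] at h
  exact_mod_cast h

/-! ### The formula in the nice regime, by induction on the dimension -/

/-- **Selberg's formula for `a > 0`, `b ≥ 1`, `c ≥ 1`**, by induction on `n = m + 1`: the base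
case is Euler's Beta integral, and the constant `K(b,c)` of Step A is forced to be `1` by Selberg's
normalisation `a S_{m+1}(a,b,c) → (m+1) S_m(2c,b,c)`. [cite: AndrewsAskeyRoy1999, §8.2, Thm. 8.1.1] -/
theorem selbergIntegral_eq_selbergProduct_nice (m : ℕ) {a b c : ℝ} (ha : 0 < a) (hb : 1 ≤ b)
    (hc : 1 ≤ c) : selbergIntegral (m + 1) a b c = selbergProduct (m + 1) a b c := by
  induction m generalizing a with
  | zero =>
    exact selbergIntegral_one_eq_selbergProduct ha (by linarith)
      (Gamma_pos_of_pos (by linarith)).ne'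
  | succ m ih =>
    obtain ⟨K, hK, hKeq⟩ := exists_const_mul (m + 1) hb hc
    have h1 := tendsto_mul_selbergIntegral_succ (m + 1) hb hc
    have h2 := tendsto_mul_selbergProduct_succ (m + 1) (b := b) (c := c) (by linarith) (by linarith)
    have h3 : Tendsto (fun a => a * selbergIntegral (m + 1 + 1) a b c) (𝓝[>] 0)
        (𝓝 (K * (((m + 1 : ℕ) : ℝ) + 1) * selbergProduct (m + 1) (2 * c) b c)) := by
      have := h2.const_mul K
      rw [← mul_assoc] at this
      refine this.congr' ?_
      filter_upwards [self_mem_nhdsWithin] with a ha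
      rw [Set.mem_Ioi] at ha
      rw [hKeq a ha]
      ring
    have hlim_eq := tendsto_nhds_unique h1 h3
    have hih : selbergIntegral (m + 1) (2 * c) b c = selbergProduct (m + 1) (2 * c) b c :=
      ih (by linarith)
    have hpos : 0 < selbergProduct (m + 1) (2 * c) b c :=
      selbergProduct_pos_of_nonneg (by omega) (by linarith) (by linarith) (by linarith)
    rw [hih] at hlim_eq
    have hX : 0 < (((m + 1 : ℕ) : ℝ) + 1) * selbergProduct (m + 1) (2 * c) b c := by positivity
    have hK1 : K = 1 := by
      have : K * ((((m + 1 : ℕ) : ℝ) + 1) * selbergProduct (m + 1) (2 * c) b c) =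
          1 * ((((m + 1 : ℕ) : ℝ) + 1) * selbergProduct (m + 1) (2 * c) b c) := by
        rw [one_mul, ← mul_assoc]; exact hlim_eq.symm
      exact mul_right_cancel₀ hX.ne' this
    rw [hKeq a ha, hK1, one_mul]

/-! ### Continuation in `b` -/

/-- **Selberg's formula for `a, b > 0`, `c ≥ 1`** (Landau continuation in `b`).
[cite: AndrewsAskeyRoy1999, Thm. 8.1.1] -/
theorem selbergIntegral_eq_selbergProduct_of_one_le (m : ℕ) {a b c : ℝ} (ha : 0 < a) (hb : 0 < b)
    (hc : 1 ≤ c) : selbergIntegral (m + 1) a b c = selbergProduct (m + 1) a b c := by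
  have hc0 : 0 ≤ c := by linarith
  set μ := cubeMeasure (m + 1) (densB (m + 1) a c) with hμ
  have hmgf : ∀ s : ℝ, mgf (XB (m + 1)) μ s = selbergIntegral (m + 1) a (s + 1) c := fun s => by
    rw [selbergIntegral_eq_mgf_B, add_sub_cancel_right]
  set G : ℂ → ℂ := fun z => selbergProductC (m + 1) a (z + 1) c with hG
  have hGdiff : DifferentiableOn ℂ G {z : ℂ | -1 < z.re} := by
    simp only [hG]
    refine differentiableOn_selbergProductC (by fun_prop) (by fun_prop) (by fun_prop)
      ?_ ?_ ?_ ?_ ?_ <;> intro z hz <;> simp only [Set.mem_setOf_eq] at hz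
    · intro j hj; simp; positivity
    · intro j hj; simp; nlinarith [hz, hc0, (by positivity : (0 : ℝ) ≤ j)]
    · intro j hj; simp; positivity
    · intro j hj
      simp
      have : (0 : ℝ) ≤ (m : ℝ) + 1 + j - 1 := by
        have : ((j : ℝ) + 1) ≤ (m : ℝ) + 1 := by exact_mod_cast hj
        linarith [(by positivity : (0 : ℝ) ≤ j)]
      nlinarith [hz, hc0, ha]
    · simp; linarith
  have hL := Landau.integrable_and_mgf_eq (μ := μ) (X := XB (m + 1)) (XB_nonpos (m + 1) a c)
    (a := -1) (s₁ := 0) (by norm_num) hGdiff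
    (fun s hs => (integrable_exp_XB_iff a c s).2 (integrableOn_weight ha (by linarith) hc0))
    (fun s hs => by
      rw [hmgf, selbergIntegral_eq_selbergProduct_nice m ha (by linarith) hc]
      simp only [hG]
      rw [← Complex.ofReal_one, ← Complex.ofReal_add, selbergProductC_ofReal])
  have h := (hL (b - 1) (by linarith)).2
  rw [hmgf, sub_add_cancel] at h
  simp only [hG] at h
  rw [← Complex.ofReal_one, ← Complex.ofReal_add, sub_add_cancel, selbergProductC_ofReal] at h
  exact_mod_cast h

/-! ### Continuation in `c` and the theorem -/

/-- **Selberg's formula on the full domain (1.2)** for `n = m + 1` (Landau continuation in `c`: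
the product side is holomorphic on `Re c > -min{1/n, a/(n-1), b/(n-1)}`).
[cite: ForresterWarnaar2008, eq. (1.1)–(1.2)] -/
theorem selbergIntegral_eq_selbergProduct (m : ℕ) {a b c : ℝ} (ha : 0 < a) (hb : 0 < b)
    (hc1 : -(1 : ℝ) / ((m + 1 : ℕ) : ℝ) < c) (hc2 : -a < (((m + 1 : ℕ) : ℝ) - 1) * c)
    (hc3 : -b < (((m + 1 : ℕ) : ℝ) - 1) * c) :
    selbergIntegral (m + 1) a b c = selbergProduct (m + 1) a b c := by
  -- the abscissa `L` below which the product side stops being holomorphic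
  set L : ℝ := if m = 0 then -1 else max (-(1 : ℝ) / ((m + 1 : ℕ) : ℝ)) (max (-a / m) (-b / m))
    with hL
  -- the three inequalities for every real `x > L`
  have hineq : ∀ x : ℝ, L < x → -(1 : ℝ) / ((m + 1 : ℕ) : ℝ) < x ∧
      -a < (((m + 1 : ℕ) : ℝ) - 1) * x ∧ -b < (((m + 1 : ℕ) : ℝ) - 1) * x := by
    intro x hx
    by_cases hm : m = 0
    · subst hm
      simp only [hL, if_true] at hx
      refine ⟨by simpa using hx, ?_, ?_⟩ <;> simp <;> linarith
    · simp only [hL, hm, if_false, max_lt_iff] at hx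
      have hm' : (0 : ℝ) < m := by exact_mod_cast Nat.pos_of_ne_zero hm
      refine ⟨hx.1, ?_, ?_⟩
      · have := (div_lt_iff₀ hm').1 hx.2.1
        push_cast
        linarith
      · have := (div_lt_iff₀ hm').1 hx.2.2
        push_cast
        linarith
  have hcL : L < c := by
    by_cases hm : m = 0
    · subst hm
      simp only [hL, if_true]
      simpa using hc1
    · simp only [hL, hm, if_false, max_lt_iff]
      have hm' : (0 : ℝ) < m := by exact_mod_cast Nat.pos_of_ne_zero hm
      refine ⟨hc1, ?_, ?_⟩
      · rw [div_lt_iff₀ hm']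
        push_cast at hc2
        linarith
      · rw [div_lt_iff₀ hm']
        push_cast at hc3
        linarith
  have hL0 : L < 0 := by
    by_cases hm : m = 0
    · subst hm
      simp [hL]
    · simp only [hL, hm, if_false, max_lt_iff]
      have hm' : (0 : ℝ) < m := by exact_mod_cast Nat.pos_of_ne_zero hm
      have hn : (0 : ℝ) < ((m + 1 : ℕ) : ℝ) := by positivity
      refine ⟨?_, ?_, ?_⟩
      · rw [neg_div]; exact neg_neg_of_pos (one_div_pos.2 hn)
      · rw [neg_div]; exact neg_neg_of_pos (div_pos ha hm')
      · rw [neg_div]; exact neg_neg_of_pos (div_pos hb hm')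
  -- Landau continuation in `c`
  set μ := cubeMeasure (m + 1) (body (m + 1) a b) with hμ
  have hmgf : ∀ s : ℝ, mgf (XC (m + 1)) μ s = selbergIntegral (m + 1) a b s := fun s =>
    (selbergIntegral_eq_mgf_C (m + 1) a b s).symm
  set G : ℂ → ℂ := fun z => selbergProductC (m + 1) a b z with hG
  have hGdiff : DifferentiableOn ℂ G {z : ℂ | L < z.re} := by
    simp only [hG]
    refine differentiableOn_selbergProductC (by fun_prop) (by fun_prop) (by fun_prop)
      ?_ ?_ ?_ ?_ ?_ <;> intro z hz <;> simp only [Set.mem_setOf_eq] at hz <;>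
      obtain ⟨i1, i2, i3⟩ := hineq z.re hz
    · intro j hj
      have h := linForm_pos ha hj i2
      simp
      linarith
    · intro j hj
      have h := linForm_pos hb hj i3
      simp
      linarith
    · intro j hj
      have h := one_add_linForm_pos hj i1
      simpa using h
    · intro j hj
      have h := sumForm_pos ha hb hj i2 i3
      simp
      push_cast at h
      linarith
    · have h := one_add_pos (n := m + 1) (by omega) i1
      simpa using h
  have hLan := Landau.integrable_and_mgf_eq (μ := μ) (X := XC (m + 1)) (XC_nonpos (m + 1) a b)
    (a := L) (s₁ := 1) (by linarith) hGdiff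
    (fun s hs => (integrable_exp_XC_iff a b s).2 (integrableOn_weight ha hb (by linarith)))
    (fun s hs => by
      rw [hmgf, selbergIntegral_eq_selbergProduct_of_one_le m ha hb hs.le]
      simp only [hG]
      rw [selbergProductC_ofReal])
  have h := (hLan c hcL).2
  rw [hmgf] at h
  simp only [hG] at h
  rw [selbergProductC_ofReal] at h
  exact_mod_cast h

end Selberg

/-- **Selberg's integral formula** (Selberg 1944; Forrester–Warnaar (1.1)–(1.2); Andrews–Askey–Roy
Thm. 8.1.1): for `n ≥ 1`, `a, b > 0` and `c > -min{1/n, a/(n-1), b/(n-1)}`,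
`Sₙ(a, b, c) = ∏_{j<n} Γ(a+jc)Γ(b+jc)Γ(1+(j+1)c) / (Γ(a+b+(n+j-1)c)Γ(1+c))`. This discharges the
named fact `selberg_integral_formula`; the proof is Aomoto's (recurrence in `a` by integration by
parts, AAR §8.2) completed by log-convexity/Bohr–Mollerup uniqueness, Selberg's normalisation
`a → 0⁺`, and Landau-type analytic continuation in `a`, `b`, `c`.
[cite: ForresterWarnaar2008, eq. (1.1)–(1.2)] -/
theorem selberg_integral_formula_holds : selberg_integral_formula := by
  intro n a b c hn ha hb hc1 hc2 hc3
  obtain ⟨m, rfl⟩ : ∃ m, n = m + 1 := ⟨n - 1, by omega⟩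
  exact Selberg.selbergIntegral_eq_selbergProduct m ha hb hc1 hc2 hc3

end Literature.Analysis.SpecialFunctions

end
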